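/-
Copyright (c) 2026 the pub-hodgecm-mathlib formalisation cell (harness21).  Prover seat hodgecm-mathlib-LH5-p02 (g2): line LH4 (Shalika pay-down), organ ‹RAO›, REGULAR class,
part (II) «SHELLS» of the three-way cut (LH4-plan (g2) WORDS #27∕#28∕#31∕#33); 2026-09-02.
-/
import Literature.NumberTheory.Automorphic.UnitaryThreeRegularUnipotentCentralizerBalls       -- ★ p849366 (this seat): scalar regCent balls, index, absorption
import Literature.NumberTheory.Automorphic.ValuationBallStableSubgroupIndex              -- ★ p849305 (this seat): ball-index growth `relIndex_mul_pow_two_le`, skew↔fixed transfer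
import Literature.NumberTheory.Rogawski1990.UnipotentLevelPiecesFrameCM                  -- ★ p846498: the `ψ` dictionary
import Literature.NumberTheory.Automorphic.LocalUnitaryIntegralLevel                     -- ★ `placeForm_antidiagOne`
import Literature.NumberTheory.Automorphic.UnitaryThreeSingularUnipotentClasses           -- ★ `exists_units_coe_eq_torusElt`, `torusElt_mem_unitaryGroupOfForm`
import Literature.NumberTheory.Automorphic.UnitaryGroupInertPlaceHyperbolicBasis          -- ★ `galAdicCompletionMap_galAdicCompletionMap_of_smul_eq`
import Literature.NumberTheory.Automorphic.AdicCompletionCompact                         -- ★ `finite_residueField_adicCompletion`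
import Literature.NumberTheory.Rogawski1990.UnipotentOrbitalIntegralConvergenceTransvectionCM  -- ★ p849314 (F0P3a-p09): carrier instances + `ψ`-dictionary idioms
import Literature.NumberTheory.Rogawski1990.UnipotentOrbitCoveringRegularCM              -- ★ p849367 (F0P3a-p09), part (I): `UnitaryGroup.exists_cover_of_regular_basePoint`
import Literature.NumberTheory.Rogawski1990.UnipotentOrbitCentralizerBallsCM            -- ★ p849437 (LH7-p03), part (II-S): `UnitaryGroup.exists_centralizerBall`, `UnitaryGroup.relIndex_centralizerBall_eq`
import Literature.NumberTheory.Automorphic.AdicCompletionIntegerSpellings               -- ★ p849331: `isUnit_two_valuedInteger_of_isUnit_two` (the `ValuativeRel` ⇒ `Valued` reading of `2 ∈ 𝒪^×`)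
import HarnessLib

/-!
# The LEVEL SHELLS of a REGULAR unipotent orbit of `U(Φ₃)(L⁺_v)` (Ranga Rao 1972; Rogawski 1990 §3.9, §8.1): shell count against centraliser growth

Topic `NumberTheory/Rogawski1990`; namespace `Literature.NumberTheory.Rogawski1990` (`UnitaryGroup.` prefix on the carrier head).  THEOREMS ONLY (no definition, no instance,
no notation, no named fact, no `sorry`); kernel lane `--supports stmt-HodgeConjecture-24833`.  Cell `pub/hodgecm-mathlib` (D-0151), crux H413 = `stmt-HodgeConjecture-24833`;
half A line LH4 (Shalika pay-down of the print row `stub_N6nsShalika`), organ ‹RAO› = the Ranga-Rao clause (iii) of `stub_ShRao`, REGULAR class.  THE THREE-WAY CUT (LH4-plan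
(g2) WORDS #27): (I) COVERING — F0P3a-p09 (g4), `UnipotentOrbitCoveringRegularCM` :: `UnitaryGroup.exists_cover_of_regular_basePoint`; (II) SHELLS — THIS FILE — with the
centraliser side (II-S) `UnipotentOrbitCentralizerBallsCM` (LH7-p03 (g2)); (B) ★ p849341 `InvariantQuotientShellSum` :: `measure_biUnion_image_mk_mul_lt_top_of_shells` (LH4-p03
(g3)); (C) `UnipotentOrbitalIntegralConvergenceRegularCM` (LH7-p01 (g2)).  HONEST LABEL: HC_CM is proved only modulo the 7 printed citations (2 remaining named inputs:
hLiu418 = stmt-HodgeConjecture-24832, h413 = stmt-HodgeConjecture-24833) until rung 0 closes; count-neutral until the leaf TIE.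

THE MATHEMATICS.  `G = U(Φ₃)(L⁺_v)` at a non-split place, `ψ : G ≃ U(σ_w, J₀)(L_w)` the one-place model (★ `localNonsplitEquiv`, frame `T = 1`), `γ₀ ∈ G` with
`ψγ₀ = u₀ = u(1, −t₀)` regular unipotent, `K_G` the hyperspecial level, `d = diag(z, 1, (σz)⁻¹)` (`v z = exp(−1)`), `ξ` skew (`σξ = −ξ`, `v ξ = exp e`), `F = (L_w)^σ` the fixed
line and `B_F(n) = {v ≤ exp n} ∩ F`.  INPUT (I) (hypothesis `hcov`): every `y` with `yγ₀y⁻¹` in a compact `C` is `k·y₁` with `k ∈ K_G`, `ψy₁ = d^j·m_κ·n(a,s)`, `j ≥ −R₁`,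
`v(t₀ + 2κξ) ≤ exp(R₂ + 2j)`.  INPUT (II-S) (hypotheses `hballs`, `hrel`): for radii `rₐ, r` the elements of `C(γ₀)` whose `ψ`-image is `ζ • n(a,s)` (`σζζ = 1`, `v a ≤ rₐ`,
`v s ≤ r`) form an OPEN subgroup, and the relative index of two such is the ball index on the skew line.  OUTPUT (the seven clauses consumed verbatim by ★ (B)): with
`j₀ = min(−R₁, 0)`, `r′ = max(R₂, τ − 2j₀, −j₀, 0)` (`v t₀ ≤ exp τ`): shells `K_G·x_{j,q}`, `x_{j,q} = ψ⁻¹(d^j m_{κ_q})`, `κ_q` running over representatives of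
`B_F(r′+2j−e) ∕ B_F(j−e)` (so `N_j = [B_F(r′+2j−e) : B_F(j−e)]` of them, §1), level subgroups `S_j = C(γ₀) ∩ ψ⁻¹(Z(U)·B_{exp(−r′), exp(2j)})`: OPEN (II-S), nested,
ABSORBED (`K_G x_{j,q} S_j ⊆ K_G x_{j,q}`, ★ p849366 `isIntMatrix_torusZpow_conj_transversal_conj_scalarRegCent`), hence COMPACT (closed in the closed `C(γ₀)` and inside
`x⁻¹K_Gx`), with GROWTH `N_j · 2^{⌊(j−2j₀)∕2⌋} ≤ [B_F(r′+2j₀−e) : B_F(2j₀−e)] · [S_j : S_{j₀}]` (★ (II-S) index + ★ p849305 `relIndex_mul_pow_two_le` on the fixed line,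
transported from the skew line by `ξ`), and COVERING `{y | yγ₀y⁻¹ ∈ C} ⊆ ⋃_{j ≥ j₀} ⋃_{q < N_j} K_G·x_{j,q}·C(γ₀)` (from (I): `κ ≡ κ_q (mod B_F(j−e))`, `m_κ = m_{κ−κ_q}·m_{κ_q}`,
`d^j m_{κ−κ_q} d^{−j} ∈ K_U` by the coset criterion ★ `isIntMatrix_torusZpow_conj_transversal_iff`, `ψ⁻¹n(a,s) ∈ C(γ₀)` by ★ `regCentElt_mem_and_commute`).  No residue-field
digits, inert and ramified places alike.

* §1 `exists_rep_of_relIndex_ne_zero` — representatives of a finite-relative-index additive subgroup, enumerated by `q < [B : A]` (pure group theory).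
* §2 **`UnitaryGroup.exists_shells_of_regular_unipotent_of_cover`** — the seven shell clauses from (I) and (II-S) taken as hypotheses (the hypothesis-free export
  `…_of_regular_unipotent` is the one-line composition with (I) ∕ (II-S) once ★ — ED. 2).

## References
* [Rao1972] R. Ranga Rao, *Orbital integrals in reductive groups*, Ann. of Math. (2) 96 (1972) 505–510, Theorem (p. 505).
* [Rogawski1990] J. D. Rogawski, *Automorphic Representations of Unitary Groups in Three Variables*, Ann. of Math. Stud. 123 (1990), §3.9 p. 32; §4.9 p. 54; §8.1 p. 112.
* [HarishChandra1999AdmissibleDistributions] Harish-Chandra, *Admissible Invariant Distributions on Reductive p-adic Groups*, AMS ULS 16 (1999), §3.1 p. 17.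
-/

set_option autoImplicit false

noncomputable section

open scoped Matrix MatrixGroups Valued WithZero Pointwise
open NumberField IsDedekindDomain Matrix

namespace Literature.NumberTheory.Rogawski1990

open Literature.NumberTheory.Automorphic Literature.NumberTheory.Automorphic.UnitaryGroup Literature.NumberTheory.GaloisRepresentations
open Literature.NumberTheory.Automorphic.HermitianLattice Literature.NumberTheory.Automorphic.UnitaryLatticeTree

/-! ## §1 Representatives of a finite-index additive subgroup, enumerated by `ℕ` -/

/-- **Representatives modulo a subgroup of finite relative index, enumerated by `q < [B : A]`**: for additive subgroups `A, B` with `[B : A ∩ B] = N ≠ 0` there is a sequence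
`κ : ℕ → M` with `κ q ∈ B` for `q < N` and every `b ∈ B` congruent to some `κ q`, `q < N`, modulo `A`. [cite: Rao1972, Theorem] -/
theorem exists_rep_of_relIndex_ne_zero {M : Type*} [AddCommGroup M] (A B : AddSubgroup M) (hN : A.relIndex B ≠ 0) :
    ∃ κ : ℕ → M, (∀ q, κ q ∈ B) ∧ ∀ b ∈ B, ∃ q, q < A.relIndex B ∧ b - κ q ∈ A := by
  classical
  haveI : (A.addSubgroupOf B).FiniteIndex := ⟨hN⟩
  let e : (↥B ⧸ A.addSubgroupOf B) ≃ Fin (A.relIndex B) := (Finite.equivFin _).trans (finCongr (by rw [AddSubgroup.relIndex, AddSubgroup.index]))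
  refine ⟨fun q => if h : q < A.relIndex B then (((e.symm ⟨q, h⟩).out : ↥B) : M) else 0, fun q => ?_, ?_⟩
  · by_cases hq : q < A.relIndex B
    · simp only [dif_pos hq]; exact SetLike.coe_mem _
    · simp only [dif_neg hq]; exact B.zero_mem
  intro b hb
  refine ⟨(e (QuotientAddGroup.mk ⟨b, hb⟩)).val, (e _).isLt, ?_⟩
  simp only [dif_pos (e _).isLt, Fin.eta, Equiv.symm_apply_apply]
  obtain ⟨h, hh⟩ := QuotientAddGroup.mk_out_eq_mul (A.addSubgroupOf B) (⟨b, hb⟩ : ↥B)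
  rw [hh, AddSubgroup.coe_add, ← sub_sub, sub_self, zero_sub]
  exact A.neg_mem (AddSubgroup.mem_addSubgroupOf.1 h.2)


/-! ## §2 The shells of the regular orbit from the covering and the centraliser balls -/

set_option maxHeartbeats 1600000 in
-- measured: the default 200 000 heartbeats time out on the final `group` normalisations of the covering clause
/-- **THE LEVEL SHELLS OF A REGULAR UNIPOTENT ORBIT OF `U(Φ₃)(L⁺_v)` — from the COVERING (I) and the CENTRALISER BALLS (II-S).**  Base point `γ₀` with `ψγ₀ = u(1, −t₀)`,
torus `d = diag(z, 1, (σz)⁻¹)` (`v z = exp(−1)`), skew `ξ ≠ 0`; given the Iwasawa covering of `{y | yγ₀y⁻¹ ∈ C}` by `K_G·ψ⁻¹(d^j m_κ n(a,s))` (`hcov`, (I)) and the open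
centraliser ball subgroups with their index (`hballs`, `hrel`, (II-S)): there are levels `j ≥ j₀`, finitely many shells `K_G·x_{j,q}` per level (`q < N j`, `x_{j,q} = ψ⁻¹(d^j m_{κ_q})`,
`κ_q` representatives of `B_F(r′+2j−e) ⁄ B_F(j−e)` on the fixed line `F`), compact open level subgroups `S_j` of `C(γ₀)` ABSORBED by the shells (`K_G x S_j ⊆ K_G x`), whose
index GROWS at least like `2^{⌊(j−2j₀)∕2⌋}` against the shell count, and the shells COVER the orbit-preimage of `C`.  The seven clauses are exactly the hypotheses of ★
`measure_biUnion_image_mk_mul_lt_top_of_shells` (p849341). [cite: Rao1972, Theorem p. 505] [cite: Rogawski1990, §3.9 p. 32; §8.1 p. 112] -/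
theorem UnitaryGroup.exists_shells_of_regular_unipotent_of_cover
    (L : Type) [Field L] [NumberField L] [IsCMField L] (v : HeightOneSpectrum (𝓞 ↥(maximalRealSubfield L)))
    (w : PlacesOver L v) (hw : IsCMField.complexConj L • w.1 = w.1) (hv2 : Valued.v (2 : (w.1.adicCompletion L)) = 1)
    {z ξ t₀ : (w.1.adicCompletion L)} (hz : Valued.v z = WithZero.exp (-1 : ℤ)) (hξ : (galAdicCompletionMap (L := L) (IsCMField.complexConj L) hw) ξ = -ξ) (hξ0 : ξ ≠ 0)
    {d : GL (Fin 3) (w.1.adicCompletion L)} (hd : (d : Matrix (Fin 3) (Fin 3) (w.1.adicCompletion L)) = Matrix.diagonal ![z, 1, ((galAdicCompletionMap (L := L) (IsCMField.complexConj L) hw) z)⁻¹])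
    (γ₀ : ((cmDatum L 3 (Matrix.of fun i j : Fin 3 => if i.val + j.val + 1 = 3 then (1 : L) else 0)).Local v)) (hγ₀ : (((localNonsplitEquiv (IsCMField.complexConj L) (Matrix.of fun i j : Fin 3 => if i.val + j.val + 1 = 3 then (1 : L) else 0) (IsCMField.complexConj_ne_one L) w hw γ₀ : ↥(unitaryGroupOfForm (galAdicCompletionMap (L := L) (IsCMField.complexConj L) hw) (placeForm (Matrix.of fun i j : Fin 3 => if i.val + j.val + 1 = 3 then (1 : L) else 0) w.1))) : GL (Fin 3) (w.1.adicCompletion L)) : Matrix (Fin 3) (Fin 3) (w.1.adicCompletion L)) = !![1, 1, -t₀; 0, 1, -1; 0, 0, 1])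
    (hcov : ∀ C : Set ((cmDatum L 3 (Matrix.of fun i j : Fin 3 => if i.val + j.val + 1 = 3 then (1 : L) else 0)).Local v), IsCompact C → ∃ R₁ R₂ : ℤ, ∀ y : ((cmDatum L 3 (Matrix.of fun i j : Fin 3 => if i.val + j.val + 1 = 3 then (1 : L) else 0)).Local v), y * γ₀ * y⁻¹ ∈ C →
      ∃ (k y₁ : ((cmDatum L 3 (Matrix.of fun i j : Fin 3 => if i.val + j.val + 1 = 3 then (1 : L) else 0)).Local v)) (j : ℤ) (κ a s : (w.1.adicCompletion L)) (m n : GL (Fin 3) (w.1.adicCompletion L)), k ∈ (cmLocalIntegralLevel L 3 (Matrix.of fun i j : Fin 3 => if i.val + j.val + 1 = 3 then (1 : L) else 0) v) ∧ y = k * y₁ ∧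
        ((localNonsplitEquiv (IsCMField.complexConj L) (Matrix.of fun i j : Fin 3 => if i.val + j.val + 1 = 3 then (1 : L) else 0) (IsCMField.complexConj_ne_one L) w hw y₁ : ↥(unitaryGroupOfForm (galAdicCompletionMap (L := L) (IsCMField.complexConj L) hw) (placeForm (Matrix.of fun i j : Fin 3 => if i.val + j.val + 1 = 3 then (1 : L) else 0) w.1))) : GL (Fin 3) (w.1.adicCompletion L)) = d ^ j * m * n ∧ (m : Matrix (Fin 3) (Fin 3) (w.1.adicCompletion L)) = !![1, κ * ξ, κ ^ 2 * ξ ^ 2 / 2; 0, 1, κ * ξ; 0, 0, 1] ∧ (n : Matrix (Fin 3) (Fin 3) (w.1.adicCompletion L)) = !![1, a, s - a ^ 2 / 2; 0, 1, -a; 0, 0, 1] ∧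
        (galAdicCompletionMap (L := L) (IsCMField.complexConj L) hw) κ = κ ∧ (galAdicCompletionMap (L := L) (IsCMField.complexConj L) hw) a = a ∧ (galAdicCompletionMap (L := L) (IsCMField.complexConj L) hw) s = -s ∧ -R₁ ≤ j ∧ Valued.v (t₀ + 2 * κ * ξ) ≤ WithZero.exp (R₂ + 2 * j))
    (hballs : ∀ ra r : ℤᵐ⁰, ra ≠ 0 → r ≠ 0 → ∃ S : Subgroup ↥(Subgroup.centralizer (({γ₀} : Set ((cmDatum L 3 (Matrix.of fun i j : Fin 3 => if i.val + j.val + 1 = 3 then (1 : L) else 0)).Local v)))),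
      (∀ h : ↥(Subgroup.centralizer (({γ₀} : Set ((cmDatum L 3 (Matrix.of fun i j : Fin 3 => if i.val + j.val + 1 = 3 then (1 : L) else 0)).Local v)))), h ∈ S ↔ ∃ ζ a s : (w.1.adicCompletion L), (galAdicCompletionMap (L := L) (IsCMField.complexConj L) hw) ζ * ζ = 1 ∧ (galAdicCompletionMap (L := L) (IsCMField.complexConj L) hw) a = a ∧ (galAdicCompletionMap (L := L) (IsCMField.complexConj L) hw) s = -s ∧ Valued.v a ≤ ra ∧ Valued.v s ≤ r ∧
        ((((localNonsplitEquiv (IsCMField.complexConj L) (Matrix.of fun i j : Fin 3 => if i.val + j.val + 1 = 3 then (1 : L) else 0) (IsCMField.complexConj_ne_one L) w hw (h : ((cmDatum L 3 (Matrix.of fun i j : Fin 3 => if i.val + j.val + 1 = 3 then (1 : L) else 0)).Local v)) : ↥(unitaryGroupOfForm (galAdicCompletionMap (L := L) (IsCMField.complexConj L) hw) (placeForm (Matrix.of fun i j : Fin 3 => if i.val + j.val + 1 = 3 then (1 : L) else 0) w.1))) : GL (Fin 3) (w.1.adicCompletion L)) : Matrix (Fin 3) (Fin 3) (w.1.adicCompletion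 L)) = ζ • !![1, a, s - a ^ 2 / 2; 0, 1, -a; 0, 0, 1])) ∧ IsOpen (S : Set ↥(Subgroup.centralizer (({γ₀} : Set ((cmDatum L 3 (Matrix.of fun i j : Fin 3 => if i.val + j.val + 1 = 3 then (1 : L) else 0)).Local v))))))
    (hrel : ∀ {ra r r' : ℤᵐ⁰} {S S' : Subgroup ↥(Subgroup.centralizer (({γ₀} : Set ((cmDatum L 3 (Matrix.of fun i j : Fin 3 => if i.val + j.val + 1 = 3 then (1 : L) else 0)).Local v))))},
      (∀ h : ↥(Subgroup.centralizer (({γ₀} : Set ((cmDatum L 3 (Matrix.of fun i j : Fin 3 => if i.val + j.val + 1 = 3 then (1 : L) else 0)).Local v)))), h ∈ S ↔ ∃ ζ a s : (w.1.adicCompletion L), (galAdicCompletionMap (L := L) (IsCMField.complexConj L) hw) ζ * ζ = 1 ∧ (galAdicCompletionMap (L := L) (IsCMField.complexConj L) hw) a = a ∧ (galAdicCompletionMap (L := L) (IsCMField.complexConj L) hw) s = -s ∧ Valued.v a ≤ ra ∧ Valued.v s ≤ r ∧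
        ((((localNonsplitEquiv (IsCMField.complexConj L) (Matrix.of fun i j : Fin 3 => if i.val + j.val + 1 = 3 then (1 : L) else 0) (IsCMField.complexConj_ne_one L) w hw (h : ((cmDatum L 3 (Matrix.of fun i j : Fin 3 => if i.val + j.val + 1 = 3 then (1 : L) else 0)).Local v)) : ↥(unitaryGroupOfForm (galAdicCompletionMap (L := L) (IsCMField.complexConj L) hw) (placeForm (Matrix.of fun i j : Fin 3 => if i.val + j.val + 1 = 3 then (1 : L) else 0) w.1))) : GL (Fin 3) (w.1.adicCompletion L)) : Matrix (Fin 3) (Fin 3) (w.1.adicCompletion L)) = ζ • !![1, a, s - a ^ 2 / 2; 0, 1, -a; 0, 0, 1])) →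
      (∀ h : ↥(Subgroup.centralizer (({γ₀} : Set ((cmDatum L 3 (Matrix.of fun i j : Fin 3 => if i.val + j.val + 1 = 3 then (1 : L) else 0)).Local v)))), h ∈ S' ↔ ∃ ζ a s : (w.1.adicCompletion L), (galAdicCompletionMap (L := L) (IsCMField.complexConj L) hw) ζ * ζ = 1 ∧ (galAdicCompletionMap (L := L) (IsCMField.complexConj L) hw) a = a ∧ (galAdicCompletionMap (L := L) (IsCMField.complexConj L) hw) s = -s ∧ Valued.v a ≤ ra ∧ Valued.v s ≤ r' ∧
        ((((localNonsplitEquiv (IsCMField.complexConj L) (Matrix.of fun i j : Fin 3 => if i.val + j.val + 1 = 3 then (1 : L) else 0) (IsCMField.complexConj_ne_one L) w hw (h : ((cmDatum L 3 (Matrix.of fun i j : Fin 3 => if i.val + j.val + 1 = 3 then (1 : L) else 0)).Local v)) : ↥(unitaryGroupOfForm (galAdicCompletionMap (L := L) (IsCMField.complexConj L) hw) (placeForm (Matrix.of fun i j : Fin 3 => if i.val + j.val + 1 = 3 then (1 : L) else 0) w.1))) : GL (Fin 3) (w.1.adicCompletion L)) : Matrix (Fin 3) (Fin 3) (w.1.adicCompletion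 L)) = ζ • !![1, a, s - a ^ 2 / 2; 0, 1, -a; 0, 0, 1])) →
      S.relIndex S' = ((Valued.v : Valuation (w.1.adicCompletion L) ℤᵐ⁰).leAddSubgroup r ⊓ (AddMonoidHom.id (w.1.adicCompletion L) + ((galAdicCompletionMap (L := L) (IsCMField.complexConj L) hw) : (w.1.adicCompletion L) →+* (w.1.adicCompletion L)).toAddMonoidHom).ker).relIndex ((Valued.v : Valuation (w.1.adicCompletion L) ℤᵐ⁰).leAddSubgroup r' ⊓ (AddMonoidHom.id (w.1.adicCompletion L) + ((galAdicCompletionMap (L := L) (IsCMField.complexConj L) hw) : (w.1.adicCompletion L) →+* (w.1.adicCompletion L)).toAddMonoidHom).ker))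
    (C : Set ((cmDatum L 3 (Matrix.of fun i j : Fin 3 => if i.val + j.val + 1 = 3 then (1 : L) else 0)).Local v)) (hC : IsCompact C) :
    ∃ (j₀ : ℤ) (N : ℤ → ℕ) (x : ℤ → ℕ → ((cmDatum L 3 (Matrix.of fun i j : Fin 3 => if i.val + j.val + 1 = 3 then (1 : L) else 0)).Local v)) (S : ℤ → Subgroup ↥(Subgroup.centralizer (({γ₀} : Set ((cmDatum L 3 (Matrix.of fun i j : Fin 3 => if i.val + j.val + 1 = 3 then (1 : L) else 0)).Local v))))) (c₃ : ℕ),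
      j₀ ≤ 0 ∧ 0 < c₃ ∧ (∀ j, j₀ ≤ j → IsCompact (S j : Set ↥(Subgroup.centralizer (({γ₀} : Set ((cmDatum L 3 (Matrix.of fun i j : Fin 3 => if i.val + j.val + 1 = 3 then (1 : L) else 0)).Local v)))))) ∧ IsOpen (S j₀ : Set ↥(Subgroup.centralizer (({γ₀} : Set ((cmDatum L 3 (Matrix.of fun i j : Fin 3 => if i.val + j.val + 1 = 3 then (1 : L) else 0)).Local v))))) ∧ (∀ j, j₀ ≤ j → S j₀ ≤ S j) ∧
      (∀ j, j₀ ≤ j → ∀ q, q < N j → ∀ k ∈ (cmLocalIntegralLevel L 3 (Matrix.of fun i j : Fin 3 => if i.val + j.val + 1 = 3 then (1 : L) else 0) v), ∀ s ∈ S j, k * x j q * (s : ((cmDatum L 3 (Matrix.of fun i j : Fin 3 => if i.val + j.val + 1 = 3 then (1 : L) else 0)).Local v)) ∈ ((cmLocalIntegralLevel L 3 (Matrix.of fun i j : Fin 3 => if i.val + j.val + 1 = 3 then (1 : L) else 0) v) : Set ((cmDatum L 3 (Matrix.of fun i j : Fin 3 => if i.val + j.val + 1 = 3 then (1 : L) else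 0)).Local v)) * {x j q}) ∧
      (∀ j, j₀ ≤ j → N j * 2 ^ ((j - 2 * j₀) / 2).toNat ≤ c₃ * (S j₀).relIndex (S j)) ∧
      {y : ((cmDatum L 3 (Matrix.of fun i j : Fin 3 => if i.val + j.val + 1 = 3 then (1 : L) else 0)).Local v) | y * γ₀ * y⁻¹ ∈ C} ⊆ ⋃ j ∈ {j : ℤ | j₀ ≤ j}, ⋃ q ∈ {q : ℕ | q < N j}, ((cmLocalIntegralLevel L 3 (Matrix.of fun i j : Fin 3 => if i.val + j.val + 1 = 3 then (1 : L) else 0) v) : Set ((cmDatum L 3 (Matrix.of fun i j : Fin 3 => if i.val + j.val + 1 = 3 then (1 : L) else 0)).Local v)) * {x j q} * ((Subgroup.centralizer (({γ₀} : Set ((cmDatum L 3 (Matrix.of fun i j : Fin 3 => if i.val + j.val + 1 = 3 then (1 : L) else 0)).Local v)))) : Set ((cmDatum L 3 (Matrix.of fun i j : Fin 3 => if i.val + j.val + 1 = 3 then (1 : L) else 0)).Local v)) := by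
  classical
  -- ## 0. The frame `ψ = e` at `T = 1` and its dictionary (as in ★ p849314)
  have hT : placeForm (Matrix.of fun i j : Fin 3 => if i.val + j.val + 1 = 3 then (1 : L) else 0) w.1 = formCongr (galAdicCompletionMap (L := L) (IsCMField.complexConj L) hw) (1 : GL (Fin 3) (w.1.adicCompletion L)) ((StdForm.antidiagonal 3).over (w.1.adicCompletion L)) := by
    rw [placeForm_antidiagOne]
    simp [formCongr, Matrix.map_one]
  have hTint : (1 : GL (Fin 3) (w.1.adicCompletion L)) ∈ glInt 3 (w.1.adicCompletion L) := Subgroup.one_mem _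
  obtain ⟨ψ, hψ⟩ : ∃ ψ : ((cmDatum L 3 (Matrix.of fun i j : Fin 3 => if i.val + j.val + 1 = 3 then (1 : L) else 0)).Local v) → GL (Fin 3) (w.1.adicCompletion L), ∀ y, ψ y = 1 * ((localNonsplitEquiv (IsCMField.complexConj L) (Matrix.of fun i j : Fin 3 => if i.val + j.val + 1 = 3 then (1 : L) else 0) (IsCMField.complexConj_ne_one L) w hw y : ↥(unitaryGroupOfForm (galAdicCompletionMap (L := L) (IsCMField.complexConj L) hw) (placeForm (Matrix.of fun i j : Fin 3 => if i.val + j.val + 1 = 3 then (1 : L) else 0) w.1))) : GL (Fin 3) (w.1.adicCompletion L)) * 1⁻¹ := ⟨_, fun _ => rfl⟩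
  have hψb : ∀ y, ψ y = ((localNonsplitEquiv (IsCMField.complexConj L) (Matrix.of fun i j : Fin 3 => if i.val + j.val + 1 = 3 then (1 : L) else 0) (IsCMField.complexConj_ne_one L) w hw y : ↥(unitaryGroupOfForm (galAdicCompletionMap (L := L) (IsCMField.complexConj L) hw) (placeForm (Matrix.of fun i j : Fin 3 => if i.val + j.val + 1 = 3 then (1 : L) else 0) w.1))) : GL (Fin 3) (w.1.adicCompletion L)) := fun y => by rw [hψ, one_mul, inv_one, mul_one]
  have hψU : ∀ y, ψ y ∈ (unitaryGroupOfForm (galAdicCompletionMap (L := L) (IsCMField.complexConj L) hw) ((StdForm.antidiagonal 3).over (w.1.adicCompletion L))) := fun y => by rw [hψ]; exact conj_localNonsplitEquiv_mem L _ v w hw hT y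
  have hψmul : ∀ y y', ψ (y * y') = ψ y * ψ y' := fun y y' => by simp only [hψ]; exact conj_localNonsplitEquiv_mul L _ v w hw y y'
  have hψinv : ∀ y, ψ y⁻¹ = (ψ y)⁻¹ := fun y => by simp only [hψ]; exact conj_localNonsplitEquiv_inv L _ v w hw y
  have hψsurj : ∀ g ∈ (unitaryGroupOfForm (galAdicCompletionMap (L := L) (IsCMField.complexConj L) hw) ((StdForm.antidiagonal 3).over (w.1.adicCompletion L))), ∃ y, ψ y = g := fun g hg => by simp only [hψ]; exact exists_conj_localNonsplitEquiv_eq L _ v w hw hT hg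
  have hψK : ∀ y, y ∈ (cmLocalIntegralLevel L 3 (Matrix.of fun i j : Fin 3 => if i.val + j.val + 1 = 3 then (1 : L) else 0) v) ↔ IsIntMatrix ((ψ y : GL (Fin 3) (w.1.adicCompletion L)) : Matrix (Fin 3) (Fin 3) (w.1.adicCompletion L)) :=
    fun y => by rw [hψ]; exact mem_cmLocalIntegralLevel_iff_isIntMatrix_conj L _ v w hw hT hTint y
  have hψinj : ∀ y y', ψ y = ψ y' → y = y' := fun y y' h => by
    rw [hψ, hψ] at h; exact conj_localNonsplitEquiv_injective L _ v w hw h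
  have hψγ₀ : ((ψ γ₀ : GL (Fin 3) (w.1.adicCompletion L)) : Matrix (Fin 3) (Fin 3) (w.1.adicCompletion L)) = !![1, 1, -t₀; 0, 1, -1; 0, 0, 1] := by rw [hψb]; exact hγ₀
  -- the local field data
  haveI : Algebra.IsQuadraticExtension ↥(maximalRealSubfield L) L := IsCMField.isQuadraticExtension L
  have hσσ : ∀ x : (w.1.adicCompletion L), (galAdicCompletionMap (L := L) (IsCMField.complexConj L) hw) ((galAdicCompletionMap (L := L) (IsCMField.complexConj L) hw) x) = x :=
    galAdicCompletionMap_galAdicCompletionMap_of_smul_eq (IsCMField.complexConj L) w (IsCMField.complexConj_ne_one L) hw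
  have hvσ : ∀ x : (w.1.adicCompletion L), Valued.v ((galAdicCompletionMap (L := L) (IsCMField.complexConj L) hw) x) = Valued.v x := fun x => valued_galAdicCompletionMap (L := L) (IsCMField.complexConj L) hw x
  have h2K : (2 : (w.1.adicCompletion L)) ≠ 0 := fun h => by rw [h, map_zero] at hv2; exact zero_ne_one hv2
  haveI : Finite 𝓀[(w.1.adicCompletion L)] := finite_residueField_adicCompletion L w.1
  have hz0 : z ≠ 0 := (Valuation.ne_zero_iff _).1 (by rw [hz]; exact WithZero.coe_ne_zero)
  have hvN : Valued.v (z * (galAdicCompletionMap (L := L) (IsCMField.complexConj L) hw) z) = WithZero.exp (-2 : ℤ) := by rw [map_mul, hvσ, hz, ← WithZero.exp_add]; norm_num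
  have hN0 : z * (galAdicCompletionMap (L := L) (IsCMField.complexConj L) hw) z ≠ 0 := mul_ne_zero hz0 ((map_ne_zero _).2 hz0)
  have hσN : (galAdicCompletionMap (L := L) (IsCMField.complexConj L) hw) (z * (galAdicCompletionMap (L := L) (IsCMField.complexConj L) hw) z) = z * (galAdicCompletionMap (L := L) (IsCMField.complexConj L) hw) z := by rw [map_mul, hσσ, mul_comm]
  have hdU : d ∈ (unitaryGroupOfForm (galAdicCompletionMap (L := L) (IsCMField.complexConj L) hw) ((StdForm.antidiagonal 3).over (w.1.adicCompletion L))) := torusElt_mem_unitaryGroupOfForm (galAdicCompletionMap (L := L) (IsCMField.complexConj L) hw) hz0 (hσσ z) hd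
  obtain ⟨e, he⟩ : ∃ e : ℤ, Valued.v ξ = WithZero.exp e := by
    have h0 : Valued.v ξ ≠ 0 := (Valuation.ne_zero_iff _).2 hξ0
    obtain ⟨x, hx⟩ := WithZero.ne_zero_iff_exists.1 h0
    exact ⟨Multiplicative.toAdd x, by rw [← hx]; rfl⟩
  obtain ⟨τ, hτ⟩ : ∃ τ : ℤ, Valued.v t₀ ≤ WithZero.exp τ := by
    rcases eq_or_ne t₀ 0 with h0 | h0
    · exact ⟨0, by rw [h0, map_zero]; exact zero_le⟩
    · have h0' : Valued.v t₀ ≠ 0 := (Valuation.ne_zero_iff _).2 h0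
      obtain ⟨x, hx⟩ := WithZero.ne_zero_iff_exists.1 h0'
      exact ⟨Multiplicative.toAdd x, by rw [← hx]; exact le_of_eq rfl⟩
  -- ## 1. Constants of the covering
  obtain ⟨R₁, R₂, hcov'⟩ := hcov C hC
  obtain ⟨j₀, hj₀R, hj₀0⟩ : ∃ j₀ : ℤ, j₀ ≤ -R₁ ∧ j₀ ≤ 0 := ⟨min (-R₁) 0, min_le_left _ _, min_le_right _ _⟩
  obtain ⟨r', hr'R, hr'τ, hr'j, hr'0⟩ : ∃ r' : ℤ, R₂ ≤ r' ∧ τ - 2 * j₀ ≤ r' ∧ -j₀ ≤ r' ∧ 0 ≤ r' :=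
    ⟨max (max R₂ (τ - 2 * j₀)) (max (-j₀) 0), le_max_of_le_left (le_max_left _ _), le_max_of_le_left (le_max_right _ _),
      le_max_of_le_right (le_max_left _ _), le_max_of_le_right (le_max_right _ _)⟩
  -- the `κ`-bound at level `j`: `v(t₀ + 2κξ) ≤ exp(R₂ + 2j) ⇒ v(κξ) ≤ exp(r′ + 2j)` (`j ≥ j₀`)
  have hκbd : ∀ {j : ℤ} {κ : (w.1.adicCompletion L)}, j₀ ≤ j → Valued.v (t₀ + 2 * κ * ξ) ≤ WithZero.exp (R₂ + 2 * j) → Valued.v (κ * ξ) ≤ WithZero.exp (r' + 2 * j) := by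
    intro j κ hj hvt
    have h2κ : Valued.v (2 * (κ * ξ)) = Valued.v (κ * ξ) := by rw [Valuation.map_mul, hv2, one_mul]
    have h2κ' : Valued.v (κ * ξ) = Valued.v ((t₀ + 2 * κ * ξ) - t₀) := by
      rw [← h2κ]; congr 1; ring
    rw [h2κ']
    refine (Valuation.map_sub _ _ _).trans (max_le (hvt.trans (WithZero.exp_le_exp.2 (by omega))) (hτ.trans (WithZero.exp_le_exp.2 (by omega))))
  -- ## 2. The fixed line `F` and the skew line `F′`
  obtain ⟨F, hF⟩ : ∃ F : AddSubgroup (w.1.adicCompletion L), ∀ x, x ∈ F ↔ (galAdicCompletionMap (L := L) (IsCMField.complexConj L) hw) x = x :=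
    ⟨{ carrier := {x | (galAdicCompletionMap (L := L) (IsCMField.complexConj L) hw) x = x}, add_mem' := fun {a b} ha hb => by simp only [Set.mem_setOf_eq] at ha hb ⊢; rw [map_add, ha, hb],
       zero_mem' := by simp, neg_mem' := fun {a} ha => by simp only [Set.mem_setOf_eq] at ha ⊢; rw [map_neg, ha] }, fun _ => Iff.rfl⟩
  have h1F : (1 : (w.1.adicCompletion L)) ∈ F := (hF 1).2 (map_one _)
  have hNF : ∀ x ∈ F, z * (galAdicCompletionMap (L := L) (IsCMField.complexConj L) hw) z * x ∈ F := fun x hx => (hF _).2 (by rw [map_mul, hσN, (hF x).1 hx])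
  have hNF' : ∀ x ∈ F, (z * (galAdicCompletionMap (L := L) (IsCMField.complexConj L) hw) z)⁻¹ * x ∈ F := fun x hx => (hF _).2 (by rw [map_mul, map_inv₀, hσN, (hF x).1 hx])
  have hFF' : ∀ y, y ∈ (AddMonoidHom.id (w.1.adicCompletion L) + ((galAdicCompletionMap (L := L) (IsCMField.complexConj L) hw) : (w.1.adicCompletion L) →+* (w.1.adicCompletion L)).toAddMonoidHom).ker ↔ ξ⁻¹ * y ∈ F := by
    intro y
    rw [AddMonoidHom.mem_ker, hF]
    change y + (galAdicCompletionMap (L := L) (IsCMField.complexConj L) hw) y = 0 ↔ (galAdicCompletionMap (L := L) (IsCMField.complexConj L) hw) (ξ⁻¹ * y) = ξ⁻¹ * y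
    rw [map_mul, map_inv₀, hξ]
    constructor
    · intro h
      rw [show (galAdicCompletionMap (L := L) (IsCMField.complexConj L) hw) y = -y by linear_combination h, inv_neg, neg_mul_neg]
    · intro h
      -- `(−ξ)⁻¹ σy = ξ⁻¹ y` ⇒ `σ y = −y` (multiply by `−ξ`)
      have h' : (galAdicCompletionMap (L := L) (IsCMField.complexConj L) hw) y = -y := by
        have h1 : (-ξ) * ((-ξ)⁻¹ * (galAdicCompletionMap (L := L) (IsCMField.complexConj L) hw) y) = (-ξ) * (ξ⁻¹ * y) := by rw [h]
        rw [← mul_assoc, mul_inv_cancel₀ (neg_ne_zero.2 hξ0), one_mul, ← mul_assoc, neg_mul, mul_inv_cancel₀ hξ0] at h1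
        rw [h1]; ring
      rw [h']; ring
  -- ## 3. The shell counts `N j = [B_F(r′+2j−e) : B_F(j−e)]` and representatives
  obtain ⟨N, hNdef⟩ : ∃ N : ℤ → ℕ, ∀ j, N j = ((Valued.v : Valuation (w.1.adicCompletion L) ℤᵐ⁰).leAddSubgroup (WithZero.exp (j - e)) ⊓ F).relIndex ((Valued.v : Valuation (w.1.adicCompletion L) ℤᵐ⁰).leAddSubgroup (WithZero.exp (r' + 2 * j - e)) ⊓ F) := ⟨_, fun _ => rfl⟩
  have hNne : ∀ j, N j ≠ 0 := fun j => by rw [hNdef]; exact relIndex_leAddSubgroup_inf_ne_zero F hz _ _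
  have hrep : ∀ j : ℤ, ∃ κ : ℕ → (w.1.adicCompletion L), (∀ q, κ q ∈ ((Valued.v : Valuation (w.1.adicCompletion L) ℤᵐ⁰).leAddSubgroup (WithZero.exp (r' + 2 * j - e)) ⊓ F)) ∧
      ∀ b ∈ ((Valued.v : Valuation (w.1.adicCompletion L) ℤᵐ⁰).leAddSubgroup (WithZero.exp (r' + 2 * j - e)) ⊓ F), ∃ q, q < N j ∧ b - κ q ∈ ((Valued.v : Valuation (w.1.adicCompletion L) ℤᵐ⁰).leAddSubgroup (WithZero.exp (j - e)) ⊓ F) := by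
    intro j
    rw [hNdef]
    exact exists_rep_of_relIndex_ne_zero _ _ (relIndex_leAddSubgroup_inf_ne_zero F hz _ _)
  choose κr hκr hκr' using hrep
  have hκF : ∀ j q, (galAdicCompletionMap (L := L) (IsCMField.complexConj L) hw) (κr j q) = κr j q := fun j q => (hF _).1 (AddSubgroup.mem_inf.1 (hκr j q)).2
  have hκv : ∀ j q, Valued.v (κr j q * ξ) ≤ WithZero.exp (r' + 2 * j) := by
    intro j q
    have h := (AddSubgroup.mem_inf.1 (hκr j q)).1
    rw [Valuation.mem_leAddSubgroup_iff] at h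
    rw [map_mul, he]
    calc Valued.v (κr j q) * WithZero.exp e ≤ WithZero.exp (r' + 2 * j - e) * WithZero.exp e := mul_le_mul_left h _
      _ = WithZero.exp (r' + 2 * j) := by rw [← WithZero.exp_add]; congr 1; ring
  -- ## 4. The shell elements `x j q = ψ⁻¹(d^j · m_(κ_q))`
  have hmex : ∀ j q, ∃ m : GL (Fin 3) (w.1.adicCompletion L), (m : Matrix (Fin 3) (Fin 3) (w.1.adicCompletion L)) = !![1, κr j q * ξ, κr j q ^ 2 * ξ ^ 2 / 2; 0, 1, κr j q * ξ; 0, 0, 1] ∧ m ∈ (unitaryGroupOfForm (galAdicCompletionMap (L := L) (IsCMField.complexConj L) hw) ((StdForm.antidiagonal 3).over (w.1.adicCompletion L))) := by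
    intro j q
    obtain ⟨m, hm, -⟩ := exists_units_coe_eq_upperTriangularUnipotent (κr j q * ξ) (κr j q ^ 2 * ξ ^ 2 / 2) (κr j q * ξ)
    exact ⟨m, hm, transversal_mem (galAdicCompletionMap (L := L) (IsCMField.complexConj L) hw) hσσ h2K hξ (hκF j q) hm⟩
  choose mκ hmκ hmκU using hmex
  have hxex : ∀ j q, ∃ y : ((cmDatum L 3 (Matrix.of fun i j : Fin 3 => if i.val + j.val + 1 = 3 then (1 : L) else 0)).Local v), ψ y = d ^ j * mκ j q := fun j q => hψsurj _ (mul_mem (zpow_mem hdU j) (hmκU j q))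
  choose x hx using hxex
  -- ## 5. The level subgroups `S j = C(γ₀) ∩ ψ⁻¹(Z(U)·B_(exp(−r′), exp(2j)))`
  have hSex : ∀ j : ℤ, ∃ S : Subgroup ↥(Subgroup.centralizer (({γ₀} : Set ((cmDatum L 3 (Matrix.of fun i j : Fin 3 => if i.val + j.val + 1 = 3 then (1 : L) else 0)).Local v)))),
      (∀ h : ↥(Subgroup.centralizer (({γ₀} : Set ((cmDatum L 3 (Matrix.of fun i j : Fin 3 => if i.val + j.val + 1 = 3 then (1 : L) else 0)).Local v)))), h ∈ S ↔ ∃ ζ a s : (w.1.adicCompletion L), (galAdicCompletionMap (L := L) (IsCMField.complexConj L) hw) ζ * ζ = 1 ∧ (galAdicCompletionMap (L := L) (IsCMField.complexConj L) hw) a = a ∧ (galAdicCompletionMap (L := L) (IsCMField.complexConj L) hw) s = -s ∧ Valued.v a ≤ WithZero.exp (-r') ∧ Valued.v s ≤ WithZero.exp (2 * j) ∧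
        ((((localNonsplitEquiv (IsCMField.complexConj L) (Matrix.of fun i j : Fin 3 => if i.val + j.val + 1 = 3 then (1 : L) else 0) (IsCMField.complexConj_ne_one L) w hw (h : ((cmDatum L 3 (Matrix.of fun i j : Fin 3 => if i.val + j.val + 1 = 3 then (1 : L) else 0)).Local v)) : ↥(unitaryGroupOfForm (galAdicCompletionMap (L := L) (IsCMField.complexConj L) hw) (placeForm (Matrix.of fun i j : Fin 3 => if i.val + j.val + 1 = 3 then (1 : L) else 0) w.1))) : GL (Fin 3) (w.1.adicCompletion L)) : Matrix (Fin 3) (Fin 3) (w.1.adicCompletion L)) = ζ • !![1, a, s - a ^ 2 / 2; 0, 1, -a; 0, 0, 1])) ∧ IsOpen (S : Set ↥(Subgroup.centralizer (({γ₀} : Set ((cmDatum L 3 (Matrix.of fun i j : Fin 3 => if i.val + j.val + 1 = 3 then (1 : L) else 0)).Local v))))) :=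
    fun j => hballs _ _ WithZero.exp_ne_zero WithZero.exp_ne_zero
  choose S hSmem hSopen using hSex
  -- ## 6. ABSORPTION `k · x j q · s ∈ K_G · x j q` (★ p849366 `isIntMatrix_torusZpow_conj_transversal_conj_scalarRegCent`)
  have habs : ∀ j, j₀ ≤ j → ∀ q, q < N j → ∀ k ∈ (cmLocalIntegralLevel L 3 (Matrix.of fun i j : Fin 3 => if i.val + j.val + 1 = 3 then (1 : L) else 0) v), ∀ s ∈ S j, k * x j q * (s : ((cmDatum L 3 (Matrix.of fun i j : Fin 3 => if i.val + j.val + 1 = 3 then (1 : L) else 0)).Local v)) ∈ ((cmLocalIntegralLevel L 3 (Matrix.of fun i j : Fin 3 => if i.val + j.val + 1 = 3 then (1 : L) else 0) v) : Set ((cmDatum L 3 (Matrix.of fun i j : Fin 3 => if i.val + j.val + 1 = 3 then (1 : L) else 0)).Local v)) * {x j q} := by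
    intro j hj q _ k hk s hs
    obtain ⟨ζ, a, s', hζ, ha, hs', hva, hvs, hrepr⟩ := (hSmem j s).1 hs
    have hψs : ((ψ (s : ((cmDatum L 3 (Matrix.of fun i j : Fin 3 => if i.val + j.val + 1 = 3 then (1 : L) else 0)).Local v)) : GL (Fin 3) (w.1.adicCompletion L)) : Matrix (Fin 3) (Fin 3) (w.1.adicCompletion L)) = ζ • !![1, a, s' - a ^ 2 / 2; 0, 1, -a; 0, 0, 1] := by rw [hψb]; exact hrepr
    have hint : x j q * (s : ((cmDatum L 3 (Matrix.of fun i j : Fin 3 => if i.val + j.val + 1 = 3 then (1 : L) else 0)).Local v)) * (x j q)⁻¹ ∈ (cmLocalIntegralLevel L 3 (Matrix.of fun i j : Fin 3 => if i.val + j.val + 1 = 3 then (1 : L) else 0) v) := by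
      rw [hψK, hψmul, hψmul, hψinv, hx]
      have hre : d ^ j * mκ j q * ψ (s : ((cmDatum L 3 (Matrix.of fun i j : Fin 3 => if i.val + j.val + 1 = 3 then (1 : L) else 0)).Local v)) * (d ^ j * mκ j q)⁻¹ = d ^ j * (mκ j q * ψ (s : ((cmDatum L 3 (Matrix.of fun i j : Fin 3 => if i.val + j.val + 1 = 3 then (1 : L) else 0)).Local v)) * (mκ j q)⁻¹) * (d ^ j)⁻¹ := by group
      rw [hre]
      exact (isIntMatrix_torusZpow_conj_transversal_conj_scalarRegCent (galAdicCompletionMap (L := L) (IsCMField.complexConj L) hw) hvσ hv2 hz (j := j) (na := r') (r' := r') le_rfl (by omega)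
        hζ hva hvs (hκv j q) hd (hmκ j q) hψs).1
    exact Set.mem_mul.2 ⟨k * (x j q * (s : ((cmDatum L 3 (Matrix.of fun i j : Fin 3 => if i.val + j.val + 1 = 3 then (1 : L) else 0)).Local v)) * (x j q)⁻¹), mul_mem hk hint, x j q, Set.mem_singleton _, by group⟩
  -- ## 7. The seven clauses
  refine ⟨j₀, N, x, S, ((Valued.v : Valuation (w.1.adicCompletion L) ℤᵐ⁰).leAddSubgroup (WithZero.exp (2 * j₀ - e)) ⊓ F).relIndex ((Valued.v : Valuation (w.1.adicCompletion L) ℤᵐ⁰).leAddSubgroup (WithZero.exp (r' + 2 * j₀ - e)) ⊓ F), hj₀0,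
    Nat.pos_of_ne_zero (relIndex_leAddSubgroup_inf_ne_zero F hz _ _), ?_, hSopen j₀, ?_, habs, ?_, ?_⟩
  · -- COMPACTNESS of `S j`, `j ≥ j₀`: an open (hence closed) subgroup of the closed `C(γ₀)` inside the compact `x⁻¹·K_G·x` (absorption with `k = 1`, `q = 0`)
    intro j hj
    have hN0 : 0 < N j := Nat.pos_of_ne_zero (hNne j)
    have hcl : IsClosed ((S j : Subgroup ↥(Subgroup.centralizer (({γ₀} : Set ((cmDatum L 3 (Matrix.of fun i j : Fin 3 => if i.val + j.val + 1 = 3 then (1 : L) else 0)).Local v))))) : Set ↥(Subgroup.centralizer (({γ₀} : Set ((cmDatum L 3 (Matrix.of fun i j : Fin 3 => if i.val + j.val + 1 = 3 then (1 : L) else 0)).Local v))))) := (S j).isClosed_of_isOpen (hSopen j)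
    obtain ⟨hKc, -⟩ := isCompact_isOpen_cmLocalIntegralLevel L 3 (Matrix.of fun i j : Fin 3 => if i.val + j.val + 1 = 3 then (1 : L) else 0) v
    have hCc : IsCompact ((fun g : ((cmDatum L 3 (Matrix.of fun i j : Fin 3 => if i.val + j.val + 1 = 3 then (1 : L) else 0)).Local v) => (x j 0)⁻¹ * g * x j 0) '' ((cmLocalIntegralLevel L 3 (Matrix.of fun i j : Fin 3 => if i.val + j.val + 1 = 3 then (1 : L) else 0) v) : Set ((cmDatum L 3 (Matrix.of fun i j : Fin 3 => if i.val + j.val + 1 = 3 then (1 : L) else 0)).Local v))) := hKc.image (by fun_prop)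
    have hHcl : IsClosed (((Subgroup.centralizer (({γ₀} : Set ((cmDatum L 3 (Matrix.of fun i j : Fin 3 => if i.val + j.val + 1 = 3 then (1 : L) else 0)).Local v)))) : Subgroup ((cmDatum L 3 (Matrix.of fun i j : Fin 3 => if i.val + j.val + 1 = 3 then (1 : L) else 0)).Local v)) : Set ((cmDatum L 3 (Matrix.of fun i j : Fin 3 => if i.val + j.val + 1 = 3 then (1 : L) else 0)).Local v)) := isClosed_coe_centralizer_singleton γ₀
    have hpre : IsCompact ((Subtype.val : ↥(Subgroup.centralizer (({γ₀} : Set ((cmDatum L 3 (Matrix.of fun i j : Fin 3 => if i.val + j.val + 1 = 3 then (1 : L) else 0)).Local v)))) → ((cmDatum L 3 (Matrix.of fun i j : Fin 3 => if i.val + j.val + 1 = 3 then (1 : L) else 0)).Local v)) ⁻¹' ((fun g : ((cmDatum L 3 (Matrix.of fun i j : Fin 3 => if i.val + j.val + 1 = 3 then (1 : L) else 0)).Local v) => (x j 0)⁻¹ * g * x j 0) '' ((cmLocalIntegralLevel L 3 (Matrix.of fun i j : Fin 3 => if i.val + j.val + 1 = 3 then (1 : L) else 0) v) : Set ((cmDatum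 L 3 (Matrix.of fun i j : Fin 3 => if i.val + j.val + 1 = 3 then (1 : L) else 0)).Local v)))) :=
      hHcl.isClosedEmbedding_subtypeVal.isCompact_preimage hCc
    refine hpre.of_isClosed_subset hcl fun s hs => ?_
    obtain ⟨k', hk', x', hx', heq⟩ := Set.mem_mul.1 (habs j hj 0 hN0 1 (Subgroup.one_mem _) s hs)
    rw [Set.mem_singleton_iff] at hx'
    rw [hx', one_mul] at heq
    refine ⟨k', hk', ?_⟩
    show (x j 0)⁻¹ * k' * x j 0 = (s : ((cmDatum L 3 (Matrix.of fun i j : Fin 3 => if i.val + j.val + 1 = 3 then (1 : L) else 0)).Local v))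
    rw [mul_assoc, heq, ← mul_assoc, inv_mul_cancel, one_mul]
  · -- MONOTONICITY `S j₀ ≤ S j`
    intro j hj h hh
    obtain ⟨ζ, a, s, hζ, ha, hs, hva, hvs, hrepr⟩ := (hSmem j₀ h).1 hh
    exact (hSmem j h).2 ⟨ζ, a, s, hζ, ha, hs, hva, hvs.trans (WithZero.exp_le_exp.2 (by omega)), hrepr⟩
  · -- GROWTH `N j · 2^⌊(j−2j₀)∕2⌋ ≤ c₃ · [S j : S j₀]` (★ p849305 on the fixed line, transported from the skew line)
    intro j hj
    rw [hNdef, hrel (hSmem j₀) (hSmem j)]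
    have htr := relIndex_leAddSubgroup_inf_eq_of_forall_mem_iff F
      (AddMonoidHom.id (w.1.adicCompletion L) + ((galAdicCompletionMap (L := L) (IsCMField.complexConj L) hw) : (w.1.adicCompletion L) →+* (w.1.adicCompletion L)).toAddMonoidHom).ker he hFF' (2 * j₀ - e) (2 * j - e)
    rw [sub_add_cancel, sub_add_cancel] at htr
    rw [htr]
    exact relIndex_mul_pow_two_le F hz hvN hNF hNF' h1F e hr'0 hj₀0 hj (by omega)
  · -- COVERING: `y = k·y₁`, `ψy₁ = d^j m_κ n(a,s)`, `κ ≡ κ_q (mod B_F(j−e))`, `m_κ = m_(κ−κ_q)·m_(κ_q)`, `d^j m_(κ−κ_q) d^(−j) ∈ K_U`, `ψ⁻¹n ∈ C(γ₀)`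
    intro y hy
    rw [Set.mem_setOf_eq] at hy
    obtain ⟨k, y₁, j, κ, a, s, m, n, hk, hyk, hψy₁, hm, hn, hσκ, hσa, hσs, hjR, hvt⟩ := hcov' y hy
    have hj : j₀ ≤ j := by omega
    have hψy₁' : ψ y₁ = d ^ j * m * n := by rw [hψb]; exact hψy₁
    -- `κ ∈ B_F(r′ + 2j − e)` and its representative `κ_q`
    have hκB : κ ∈ ((Valued.v : Valuation (w.1.adicCompletion L) ℤᵐ⁰).leAddSubgroup (WithZero.exp (r' + 2 * j - e)) ⊓ F) := by
      refine AddSubgroup.mem_inf.2 ⟨?_, (hF κ).2 hσκ⟩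
      rw [Valuation.mem_leAddSubgroup_iff]
      have h1 := hκbd hj hvt
      have hvκ : Valued.v κ = Valued.v (κ * ξ) * WithZero.exp (-e) := by
        rw [map_mul, he, mul_assoc, ← WithZero.exp_add, add_neg_cancel, WithZero.exp_zero, mul_one]
      rw [hvκ]
      calc Valued.v (κ * ξ) * WithZero.exp (-e) ≤ WithZero.exp (r' + 2 * j) * WithZero.exp (-e) := mul_le_mul_left h1 _
        _ = WithZero.exp (r' + 2 * j - e) := by rw [← WithZero.exp_add]; congr 1
    obtain ⟨q, hq, hδ⟩ := hκr' j κ hκB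
    obtain ⟨hδv, hδF⟩ := AddSubgroup.mem_inf.1 hδ
    rw [Valuation.mem_leAddSubgroup_iff] at hδv
    have hσδ : (galAdicCompletionMap (L := L) (IsCMField.complexConj L) hw) (κ - κr j q) = κ - κr j q := (hF _).1 hδF
    -- the transversal element `m′ = m_(κ−κ_q)`: `m = m′ · m_(κ_q)` and `d^j m′ d^(−j)` is integral
    obtain ⟨m', hm', -⟩ := exists_units_coe_eq_upperTriangularUnipotent ((κ - κr j q) * ξ) ((κ - κr j q) ^ 2 * ξ ^ 2 / 2) ((κ - κr j q) * ξ)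
    have hmm' : m = m' * mκ j q := Units.ext (by rw [hm, coe_transversal_mul h2K hm' (hmκ j q), sub_add_cancel])
    have hm'int : IsIntMatrix ((d ^ j * m' * (d ^ j)⁻¹ : GL (Fin 3) (w.1.adicCompletion L)) : Matrix (Fin 3) (Fin 3) (w.1.adicCompletion L)) := by
      rw [isIntMatrix_torusZpow_conj_transversal_iff (galAdicCompletionMap (L := L) (IsCMField.complexConj L) hw) hvσ hv2 hz0 j hd hm', map_mul, map_mul, map_zpow₀, hz, he,
        ← WithZero.exp_zsmul, smul_eq_mul, mul_neg, mul_one]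
      calc WithZero.exp (-j) * (Valued.v (κ - κr j q) * WithZero.exp e)
          ≤ WithZero.exp (-j) * (WithZero.exp (j - e) * WithZero.exp e) := mul_le_mul_right (mul_le_mul_left hδv _) _
        _ = 1 := by rw [← WithZero.exp_add, ← WithZero.exp_add, ← WithZero.exp_zero]; congr 1; ring
    -- the centraliser element `h₀ = ψ⁻¹ n(a,s)`
    obtain ⟨hnU, hncomm⟩ := regCentElt_mem_and_commute (galAdicCompletionMap (L := L) (IsCMField.complexConj L) hw) hσσ h2K hσa hσs hψγ₀ hn
    obtain ⟨h₀, hh₀⟩ := hψsurj n hnU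
    have hh₀H : h₀ ∈ (Subgroup.centralizer (({γ₀} : Set ((cmDatum L 3 (Matrix.of fun i j : Fin 3 => if i.val + j.val + 1 = 3 then (1 : L) else 0)).Local v)))) := by
      rw [Subgroup.mem_centralizer_singleton_iff]
      apply hψinj
      rw [hψmul, hψmul, hh₀]
      exact hncomm
    -- the integral element `k″ = y₁ · h₀⁻¹ · (x j q)⁻¹`, `ψ k″ = d^j m′ d^(−j)`
    have hk'' : y₁ * h₀⁻¹ * (x j q)⁻¹ ∈ (cmLocalIntegralLevel L 3 (Matrix.of fun i j : Fin 3 => if i.val + j.val + 1 = 3 then (1 : L) else 0) v) := by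
      rw [hψK, hψmul, hψmul, hψinv, hψinv, hx, hh₀, hψy₁', hmm']
      have hre : d ^ j * (m' * mκ j q) * n * n⁻¹ * (d ^ j * mκ j q)⁻¹ = d ^ j * m' * (d ^ j)⁻¹ := by group
      rw [hre]; exact hm'int
    refine Set.mem_iUnion₂.2 ⟨j, hj, Set.mem_iUnion₂.2 ⟨q, hq, ?_⟩⟩
    refine Set.mem_mul.2 ⟨k * (y₁ * h₀⁻¹ * (x j q)⁻¹) * x j q,
      Set.mem_mul.2 ⟨k * (y₁ * h₀⁻¹ * (x j q)⁻¹), mul_mem hk hk'', x j q, Set.mem_singleton _, rfl⟩, h₀, hh₀H, ?_⟩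
    rw [hyk]; group

/-- **THE LEVEL SHELLS OF A REGULAR UNIPOTENT ORBIT — HYPOTHESIS-FREE EXPORT (ED. 2).**  For `L∕L⁺` CM, `v` a finite place of `L⁺` with `w | v` fixed by `c`
(inert or ramified), `2 ∈ 𝒪[L_w]^×`, and `γ₀ ∈ G = U(Φ₃)(L⁺_v)` with `ψ γ₀ = u₀ = !![1, 1, −t₀; 0, 1, −1; 0, 0, 1]` (a regular unipotent in the one-place frame `ψ`), and every
compact `C ⊆ G`: there are levels `j ≥ j₀` (`j₀ ≤ 0`), finitely many shells `K_G · x_{j,q}` per level (`q < N j`), compact level subgroups `S j ≤ C(γ₀)` increasing in `j` with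
`S j₀` open, ABSORPTION `K_G · x_{j,q} · S j ⊆ K_G · x_{j,q}`, GROWTH `N j · 2^{⌊(j − 2j₀)∕2⌋} ≤ c₃ · [S j : S j₀]`, and COVERING `{y | y γ₀ y⁻¹ ∈ C} ⊆ ⋃ K_G x_{j,q} C(γ₀)` — the
seven hypotheses of ★ `measure_biUnion_image_mk_mul_lt_top_of_shells'` (p849341), whence the convergence of the regular unipotent orbital integral (consumer: (C) ED. 3).
Assembled from `exists_shells_of_regular_unipotent_of_cover` with the uniformiser `z = π_L` (Mathlib `valuation_exists_uniformizer`), the skew unit `ξ = x₀ − σx₀ ≠ 0`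
(★ `Liu2021.exists_galAdicCompletionMap_ne`), the torus element `d(z)` (★ `exists_units_coe_eq_torusElt`), `v(2) = 1` (★ `isUnit_two_valuedInteger_of_isUnit_two`), the
COVERING (I) ★ `exists_cover_of_regular_basePoint` (p849367) and the CENTRALISER BALLS (II-S) ★ `exists_centralizerBall` ∕ `relIndex_centralizerBall_eq` (p849437).
[cite: Rao1972, Theorem] [cite: Rogawski1990, §3.9 p. 32, §8.1 p. 112] -/
theorem UnitaryGroup.exists_shells_of_regular_unipotent
    (L : Type) [Field L] [NumberField L] [IsCMField L] (v : HeightOneSpectrum (𝓞 ↥(maximalRealSubfield L)))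
    (w : PlacesOver L v) (hw : IsCMField.complexConj L • w.1 = w.1) (h2 : IsUnit (2 : (ValuativeRel.valuation (w.1.adicCompletion L)).integer))
    (γ₀ : ((cmDatum L 3 (Matrix.of fun i j : Fin 3 => if i.val + j.val + 1 = 3 then (1 : L) else 0)).Local v)) {t₀ : (w.1.adicCompletion L)} (hγ₀ : (((localNonsplitEquiv (IsCMField.complexConj L) (Matrix.of fun i j : Fin 3 => if i.val + j.val + 1 = 3 then (1 : L) else 0) (IsCMField.complexConj_ne_one L) w hw γ₀ : ↥(unitaryGroupOfForm (galAdicCompletionMap (L := L) (IsCMField.complexConj L) hw) (placeForm (Matrix.of fun i j : Fin 3 => if i.val + j.val + 1 = 3 then (1 : L) else 0) w.1))) : GL (Fin 3) (w.1.adicCompletion L)) : Matrix (Fin 3) (Fin 3) (w.1.adicCompletion L)) = !![1, 1, -t₀; 0, 1, -1; 0, 0, 1])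
    (C : Set ((cmDatum L 3 (Matrix.of fun i j : Fin 3 => if i.val + j.val + 1 = 3 then (1 : L) else 0)).Local v)) (hC : IsCompact C) :
    ∃ (j₀ : ℤ) (N : ℤ → ℕ) (x : ℤ → ℕ → ((cmDatum L 3 (Matrix.of fun i j : Fin 3 => if i.val + j.val + 1 = 3 then (1 : L) else 0)).Local v)) (S : ℤ → Subgroup ↥(Subgroup.centralizer (({γ₀} : Set ((cmDatum L 3 (Matrix.of fun i j : Fin 3 => if i.val + j.val + 1 = 3 then (1 : L) else 0)).Local v))))) (c₃ : ℕ),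
      j₀ ≤ 0 ∧ 0 < c₃ ∧ (∀ j, j₀ ≤ j → IsCompact (S j : Set ↥(Subgroup.centralizer (({γ₀} : Set ((cmDatum L 3 (Matrix.of fun i j : Fin 3 => if i.val + j.val + 1 = 3 then (1 : L) else 0)).Local v)))))) ∧ IsOpen (S j₀ : Set ↥(Subgroup.centralizer (({γ₀} : Set ((cmDatum L 3 (Matrix.of fun i j : Fin 3 => if i.val + j.val + 1 = 3 then (1 : L) else 0)).Local v))))) ∧ (∀ j, j₀ ≤ j → S j₀ ≤ S j) ∧
      (∀ j, j₀ ≤ j → ∀ q, q < N j → ∀ k ∈ (cmLocalIntegralLevel L 3 (Matrix.of fun i j : Fin 3 => if i.val + j.val + 1 = 3 then (1 : L) else 0) v), ∀ s ∈ S j, k * x j q * (s : ((cmDatum L 3 (Matrix.of fun i j : Fin 3 => if i.val + j.val + 1 = 3 then (1 : L) else 0)).Local v)) ∈ ((cmLocalIntegralLevel L 3 (Matrix.of fun i j : Fin 3 => if i.val + j.val + 1 = 3 then (1 : L) else 0) v) : Set ((cmDatum L 3 (Matrix.of fun i j : Fin 3 => if i.val + j.val + 1 = 3 then (1 : L) else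 0)).Local v)) * {x j q}) ∧
      (∀ j, j₀ ≤ j → N j * 2 ^ ((j - 2 * j₀) / 2).toNat ≤ c₃ * (S j₀).relIndex (S j)) ∧
      {y : ((cmDatum L 3 (Matrix.of fun i j : Fin 3 => if i.val + j.val + 1 = 3 then (1 : L) else 0)).Local v) | y * γ₀ * y⁻¹ ∈ C} ⊆ ⋃ j ∈ {j : ℤ | j₀ ≤ j}, ⋃ q ∈ {q : ℕ | q < N j}, ((cmLocalIntegralLevel L 3 (Matrix.of fun i j : Fin 3 => if i.val + j.val + 1 = 3 then (1 : L) else 0) v) : Set ((cmDatum L 3 (Matrix.of fun i j : Fin 3 => if i.val + j.val + 1 = 3 then (1 : L) else 0)).Local v)) * {x j q} * ((Subgroup.centralizer (({γ₀} : Set ((cmDatum L 3 (Matrix.of fun i j : Fin 3 => if i.val + j.val + 1 = 3 then (1 : L) else 0)).Local v)))) : Set ((cmDatum L 3 (Matrix.of fun i j : Fin 3 => if i.val + j.val + 1 = 3 then (1 : L) else 0)).Local v)) := by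
  classical
  -- `v(2) = 1` in the `Valued` reading, from `2 ∈ 𝒪[L_w]^×` in the `ValuativeRel` reading (★ p849331 + Mathlib)
  have hv2 : Valued.v (2 : (w.1.adicCompletion L)) = 1 := by
    have h := Valuation.Integers.one_of_isUnit (Valuation.integer.integers (Valued.v : Valuation (w.1.adicCompletion L) ℤᵐ⁰))
      (isUnit_two_valuedInteger_of_isUnit_two L w.1 h2)
    rw [map_ofNat] at h
    exact h
  -- a uniformiser `z = π_L` of `L_w` (Mathlib)
  obtain ⟨πL, hπL⟩ := w.1.valuation_exists_uniformizer L
  have hz : Valued.v ((πL : L) : (w.1.adicCompletion L)) = WithZero.exp (-1 : ℤ) := by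
    rw [HeightOneSpectrum.valuedAdicCompletion_eq_valuation', hπL]
  have hz0 : ((πL : L) : (w.1.adicCompletion L)) ≠ 0 := by
    intro h
    rw [h, map_zero] at hz
    exact WithZero.exp_ne_zero hz.symm
  -- a non-zero skew element `ξ = x₀ − σ x₀` (★ `Liu2021.exists_galAdicCompletionMap_ne`: `σ_w ≠ id`)
  obtain ⟨x₀, hx₀⟩ := Literature.NumberTheory.Automorphic.Liu2021.exists_galAdicCompletionMap_ne _ L (IsCMField.complexConj L) (IsCMField.complexConj_ne_one L) hw
  haveI : Algebra.IsQuadraticExtension ↥(maximalRealSubfield L) L := IsCMField.isQuadraticExtension L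
  have hσσ : ∀ y : (w.1.adicCompletion L), (galAdicCompletionMap (L := L) (IsCMField.complexConj L) hw) ((galAdicCompletionMap (L := L) (IsCMField.complexConj L) hw) y) = y :=
    galAdicCompletionMap_galAdicCompletionMap_of_smul_eq (IsCMField.complexConj L) w (IsCMField.complexConj_ne_one L) hw
  have hξ : (galAdicCompletionMap (L := L) (IsCMField.complexConj L) hw) (x₀ - (galAdicCompletionMap (L := L) (IsCMField.complexConj L) hw) x₀) = -(x₀ - (galAdicCompletionMap (L := L) (IsCMField.complexConj L) hw) x₀) := by
    rw [map_sub, hσσ, neg_sub]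
  have hξ0 : x₀ - (galAdicCompletionMap (L := L) (IsCMField.complexConj L) hw) x₀ ≠ 0 := fun h => hx₀ (sub_eq_zero.1 h).symm
  -- the torus element `d = diag(z, 1, (σz)⁻¹)` (★ `exists_units_coe_eq_torusElt`)
  obtain ⟨d, hd, -⟩ := exists_units_coe_eq_torusElt (galAdicCompletionMap (L := L) (IsCMField.complexConj L) hw) hz0
  exact UnitaryGroup.exists_shells_of_regular_unipotent_of_cover L v w hw hv2 hz hξ hξ0 hd γ₀ hγ₀
    (fun C hC => UnitaryGroup.exists_cover_of_regular_basePoint L v w hw h2 hz hξ hξ0 hd γ₀ hγ₀ C hC)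
    (fun ra r hra hr => UnitaryGroup.exists_centralizerBall L v w hw γ₀ hγ₀ ra r hra hr)
    (fun hS hS' => UnitaryGroup.relIndex_centralizerBall_eq L v w hw γ₀ hγ₀ hS hS') C hC

end Literature.NumberTheory.Rogawski1990

end
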